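import Literature.Analysis.FluidPDE.HeatPotentialHolder
import Literature.Analysis.FluidPDE.ParabolicSingularPotentialsFwd
import HarnessLib

/-!
# Prop. 13.4 of Lemarié-Rieusset 2016 from decay estimates on the kernel of `σ(D)e^{Δ}`

Analysis/FluidPDE file in the decomposition of the named fact
`Literature.Analysis.FluidPDE.LemarieRieusset2016.prop13_4` (`ParabolicHeatPotentials.lean`:
Lemarié-Rieusset 2016, Prop. 13.4 p. 464), towards `LemarieRieusset2016.lemma13_6`. With the
heat-kernel part proved (`HeatPotentialHolder.lean`) and the forward-kernel Hölder theorem and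
absolute convergence proved (`ParabolicSingularPotentialsFwd.lean`), the `σ(D)g`-part of
Prop. 13.4 only needs the parabolic estimates of the kernel `σ(D)W₊ = 1_{t>0} σ(D)W_{νt}` quoted on
p. 465. For a symbol `σ` homogeneous of degree `1`, the kernel `K_θ = 𝓕⁻(σ · e^{-4π²θ|ξ|²})` of
`σ(D)e^{θΔ}` comes from the single function `K₁ = multiplierHeatKernel σ 1` by parabolic scaling,
`K_θ(y) = θ⁻² K₁(y/√θ)` (`multiplierHeatKernel_scaling`, **proved**: substitution `ξ = η/√θ` and
`σ(η/√θ) = θ^{-1/2}σ(η)`), so those estimates reduce to three decay estimates on `K₁` and its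
gradient, which this file vendors as its one named fact:

* `LemarieRieusset2016.gaussianMultiplierKernel_estimates` — **named fact**: `K₁` is
  differentiable with `|K₁(u)|(1+|u|)⁴ ≤ C`, `‖∇K₁(u)‖(1+|u|)⁵ ≤ C` and
  `|2K₁(u) + ½ u·∇K₁(u)|(1+|u|)⁶ ≤ C` (the last expression is `-∂_θ[θ⁻²K₁(u/√θ)]|_{θ=1} = -ΔK₁`;
  these are the decay rates `|u|^{-3-k}` of inverse Fourier transforms of symbols with a homogeneous
  singularity of degree `k = 1, 2, 3` at the origin, times a Gaussian);
* `multiplierHeatKernelFwd_estimates` — **proved**: measurability of `σ(D)W₊` (from the scaling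
  formula, `K₁` being continuous), the size bound `|σ(D)W₊|ρ₂⁴ ≤ A` and the regularity bound
  `|σ(D)W₊(z) - σ(D)W₊(z-z')|ρ₂(z)⁵ ≤ Aρ₂(z')` in the region `t > 0` (mean value inequality in space,
  then in time, as for `W₊` in `HeatKernelParabolicBounds.lean`; across `t = 0` the kernel jumps by
  `σ(D)δ ≠ 0`, so no more can hold);
* `LemarieRieusset2016.prop13_4_multiplierPart_of_gaussian` — **proved**:
  `gaussianMultiplierKernel_estimates → prop13_4_multiplierPart`
  (`parabolicHolderOnWith_integral_of_kernel_bounds_fwd` with `m = 4`, `d = 5(1 - 1/q₁) = 4 + α`);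
* `LemarieRieusset2016.prop13_4_of_gaussian` — **proved**:
  `gaussianMultiplierKernel_estimates → prop13_4`.

## References

* P. G. Lemarié-Rieusset, *The Navier–Stokes Problem in the 21st Century*, CRC Press (2016),
  Prop. 13.4 and its proof, pp. 464–465. [LemarieRieusset2016]
* O. A. Ladyzhenskaya, V. A. Solonnikov, N. N. Ural'tseva, *Linear and quasi-linear equations of
  parabolic type*, AMS (1968), Ch. IV §1 (parabolic singular kernels).
* E. M. Stein, *Harmonic Analysis*, Princeton (1993), Ch. VI §4 (kernels of symbols).
-/

noncomputable section

open MeasureTheory Set Function Filter Metric Real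
open scoped NNReal ENNReal RealInnerProductSpace FourierTransform

namespace Literature.Analysis.FluidPDE

/-- Local notation for physical space `ℝ³ = EuclideanSpace ℝ (Fin 3)`. -/
local notation "ℝ³" => EuclideanSpace ℝ (Fin 3)

/-! ### Parabolic scaling of the multiplier heat kernel -/

section Scaling

/-- **Parabolic scaling of the kernel of `σ(D)e^{θΔ}`**: for `σ` homogeneous of degree `1` and
`θ > 0`, `K_θ(y) = θ⁻² K₁(y/√θ)` where `K_θ = multiplierHeatKernel σ θ` (substitute `ξ = η/√θ`
in `K_θ(y) = ∫ e^{2πi⟨ξ,y⟩} σ(ξ) e^{-4π²θ|ξ|²} dξ`: `σ(η/√θ) = θ^{-1/2} σ(η)`, `dξ = θ^{-3/2} dη`). [folklore] -/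
theorem multiplierHeatKernel_scaling {σ : ℝ³ → ℂ}
    (hhom : ∀ c : ℝ, 0 < c → ∀ ξ : ℝ³, σ (c • ξ) = (c : ℂ) * σ ξ) {θ : ℝ} (hθ : 0 < θ) (y : ℝ³) :
    multiplierHeatKernel σ θ y =
      ((θ ^ 2)⁻¹ : ℝ) • multiplierHeatKernel σ 1 ((Real.sqrt θ)⁻¹ • y) := by
  set c : ℝ := Real.sqrt θ with hc
  have hc0 : 0 < c := Real.sqrt_pos.2 hθ
  have hc2 : c ^ 2 = θ := Real.sq_sqrt hθ.le
  unfold multiplierHeatKernel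
  rw [Real.fourierInv_eq', Real.fourierInv_eq']
  -- the integrand at `θ` is the rescaled integrand at `1`
  set g : ℝ³ → ℂ := fun v => Complex.exp (↑(2 * π * ⟪v, c⁻¹ • y⟫) * Complex.I) •
    (σ v * (UnboundedOperators.heatSymbol 1 v : ℂ)) with hg
  have key : ∀ v : ℝ³, Complex.exp (↑(2 * π * ⟪v, y⟫) * Complex.I) •
      (σ v * (UnboundedOperators.heatSymbol θ v : ℂ)) = (c⁻¹ : ℂ) * g (c • v) := by
    intro v
    rw [hg]
    simp only
    have h1 : ⟪c • v, c⁻¹ • y⟫ = ⟪v, y⟫ := by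
      rw [real_inner_smul_left, real_inner_smul_right, ← mul_assoc, mul_inv_cancel₀ hc0.ne', one_mul]
    have h2 : σ (c • v) = (c : ℂ) * σ v := hhom c hc0 v
    have h3 : UnboundedOperators.heatSymbol 1 (c • v) = UnboundedOperators.heatSymbol θ v := by
      simp only [UnboundedOperators.heatSymbol, norm_smul, Real.norm_eq_abs, abs_of_pos hc0, mul_pow, hc2]
      ring_nf
    rw [h1, h2, h3, smul_eq_mul, smul_eq_mul]
    have hcne : (c : ℂ) ≠ 0 := by exact_mod_cast hc0.ne'
    field_simp
  simp_rw [key]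
  rw [integral_const_mul, Measure.integral_comp_smul_of_nonneg volume g c (hR := hc0.le),
    finrank_euclideanSpace_three]
  -- scalars: `c⁻¹ (c³)⁻¹ = (θ²)⁻¹`
  rw [Complex.real_smul, Complex.real_smul, ← mul_assoc]
  congr 1
  have : (c⁻¹ : ℂ) * (((c ^ 3)⁻¹ : ℝ) : ℂ) = (((θ ^ 2)⁻¹ : ℝ) : ℂ) := by
    rw [← hc2]
    push_cast
    field_simp
  rw [this]

end Scaling

/-! ### The estimates on `K₁` (named fact) -/

namespace LemarieRieusset2016

/-- **Decay of the kernel of `σ(D)e^{Δ}` and of its gradient** (the analytic input of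
Lemarié-Rieusset 2016, Prop. 13.4, proof p. 465, "the size estimates … are easily established
(see Ladyzhenskaya et al. [298] for instance, or our estimates in Chapter 5)"). Let
`σ : ℝ³ → ℂ` be smooth on `ℝ³ ∖ {0}` and homogeneous of degree `1`, and let
`K₁ = 𝓕⁻(σ · e^{-4π²|ξ|²}) = multiplierHeatKernel σ 1` be the kernel of `σ(D)e^{Δ}`. Then `K₁` is
differentiable on `ℝ³`, with derivative `D`, and for some `C`: `|K₁(u)| (1 + |u|)⁴ ≤ C`,
`‖D(u)‖ (1 + |u|)⁵ ≤ C`, and `|2K₁(u) + ½ D(u)u| (1 + |u|)⁶ ≤ C` for all `u` (the last quantity is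
`-∂_θ[θ⁻²K₁(u/√θ)]|_{θ=1} = -ΔK₁(u)`; the three are the decay rates `|u|^{-3-k}` of the inverse
Fourier transforms of the symbols `σ`, `ξⱼσ`, `|ξ|²σ`, homogeneous of degree `k = 1, 2, 3` near
the origin, times the Gaussian). [cite: LemarieRieusset2016, Prop. 13.4 proof p. 465] -/
def gaussianMultiplierKernel_estimates : Prop :=
  ∀ σ : ℝ³ → ℂ, ContDiffOn ℝ ((⊤ : ℕ∞) : WithTop ℕ∞) σ {0}ᶜ →
    (∀ c : ℝ, 0 < c → ∀ ξ : ℝ³, σ (c • ξ) = (c : ℂ) * σ ξ) →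
    ∃ (D : ℝ³ → ℝ³ →L[ℝ] ℂ) (C : ℝ),
      (∀ u, HasFDerivAt (multiplierHeatKernel σ 1) (D u) u) ∧
      (∀ u, ‖multiplierHeatKernel σ 1 u‖ * (1 + ‖u‖) ^ 4 ≤ C) ∧
      (∀ u, ‖D u‖ * (1 + ‖u‖) ^ 5 ≤ C) ∧
      (∀ u, ‖2 * multiplierHeatKernel σ 1 u + (1 / 2 : ℂ) * D u u‖ * (1 + ‖u‖) ^ 6 ≤ C)

end LemarieRieusset2016

/-! ### The rescaled kernel and its derivatives -/

section Rescaled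

variable {K₁ : ℝ³ → ℂ} {D : ℝ³ → ℝ³ →L[ℝ] ℂ} {C : ℝ}

/-- `(1 + |u|)` at `u = v/a`: `1 + |a⁻¹v| = (a + |v|)/a` for `a > 0`. [folklore] -/
theorem one_add_norm_inv_smul {a : ℝ} (ha : 0 < a) (v : ℝ³) :
    1 + ‖a⁻¹ • v‖ = (a + ‖v‖) / a := by
  rw [norm_smul, Real.norm_eq_abs, abs_of_pos (inv_pos.2 ha)]
  field_simp

/-- **Size of the rescaled kernel**: from `|K₁(u)|(1+|u|)⁴ ≤ C`,
`|(θ²)⁻¹ K₁(v/√θ)| ≤ C/(√θ + |v|)⁴` for `θ > 0`. [folklore] -/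
theorem norm_rescaled_le (hb : ∀ u, ‖K₁ u‖ * (1 + ‖u‖) ^ 4 ≤ C) {θ : ℝ} (hθ : 0 < θ) (v : ℝ³) :
    ‖((θ ^ 2)⁻¹ : ℝ) • K₁ ((Real.sqrt θ)⁻¹ • v)‖ ≤ C / (Real.sqrt θ + ‖v‖) ^ 4 := by
  set a : ℝ := Real.sqrt θ with ha
  have ha0 : 0 < a := Real.sqrt_pos.2 hθ
  have ha2 : a ^ 2 = θ := Real.sq_sqrt hθ.le
  set u : ℝ³ := a⁻¹ • v with hu
  have hav : 0 < a + ‖v‖ := by positivity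
  have h1 : 1 + ‖u‖ = (a + ‖v‖) / a := one_add_norm_inv_smul ha0 v
  have hC : ‖K₁ u‖ ≤ C / (1 + ‖u‖) ^ 4 := by
    rw [le_div_iff₀ (by positivity)]
    exact hb u
  rw [norm_smul, Real.norm_eq_abs, abs_of_pos (by positivity), ← ha2]
  calc ((a ^ 2) ^ 2)⁻¹ * ‖K₁ u‖ = (a ^ 4)⁻¹ * ‖K₁ u‖ := by ring
    _ ≤ (a ^ 4)⁻¹ * (C / (1 + ‖u‖) ^ 4) := by gcongr
    _ = C / (a + ‖v‖) ^ 4 := by rw [h1]; field_simp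

/-- **Derivative along a spatial segment of the rescaled kernel**: for `θ > 0`,
`d/dμ [(θ²)⁻¹ K₁((√θ)⁻¹(w + μ b))] = (θ²)⁻¹ D((√θ)⁻¹(w + μb)) ((√θ)⁻¹ b)`. [folklore] -/
theorem hasDerivAt_rescaled_segment (hd : ∀ u, HasFDerivAt K₁ (D u) u) (θ : ℝ)
    (w b : ℝ³) (μ : ℝ) :
    HasDerivAt (fun μ : ℝ => ((θ ^ 2)⁻¹ : ℝ) • K₁ ((Real.sqrt θ)⁻¹ • (w + μ • b)))
      (((θ ^ 2)⁻¹ : ℝ) • D ((Real.sqrt θ)⁻¹ • (w + μ • b)) ((Real.sqrt θ)⁻¹ • b)) μ := by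
  have hp : HasDerivAt (fun μ : ℝ => (Real.sqrt θ)⁻¹ • (w + μ • b)) ((Real.sqrt θ)⁻¹ • b) μ := by
    have h1 : HasDerivAt (fun μ : ℝ => w + μ • b) b μ := by
      simpa using ((hasDerivAt_id μ).smul_const b).const_add w
    exact h1.const_smul ((Real.sqrt θ)⁻¹)
  have hcomp := (hd ((Real.sqrt θ)⁻¹ • (w + μ • b))).comp_hasDerivAt μ hp
  exact hcomp.const_smul (((θ ^ 2)⁻¹ : ℝ))

/-- **Bound for the spatial derivative**: from `‖D(u)‖(1+|u|)⁵ ≤ C`,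
`‖(θ²)⁻¹ D((√θ)⁻¹ṽ)((√θ)⁻¹ b)‖ ≤ C |b| / (√θ + |ṽ|)⁵`. [folklore] -/
theorem norm_rescaled_spaceDeriv_le (hc : ∀ u, ‖D u‖ * (1 + ‖u‖) ^ 5 ≤ C) {θ : ℝ} (hθ : 0 < θ)
    (v b : ℝ³) :
    ‖((θ ^ 2)⁻¹ : ℝ) • D ((Real.sqrt θ)⁻¹ • v) ((Real.sqrt θ)⁻¹ • b)‖ ≤
      C * ‖b‖ / (Real.sqrt θ + ‖v‖) ^ 5 := by
  set a : ℝ := Real.sqrt θ with ha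
  have ha0 : 0 < a := Real.sqrt_pos.2 hθ
  have ha2 : a ^ 2 = θ := Real.sq_sqrt hθ.le
  set u : ℝ³ := a⁻¹ • v with hu
  have hav : 0 < a + ‖v‖ := by positivity
  have h1 : 1 + ‖u‖ = (a + ‖v‖) / a := one_add_norm_inv_smul ha0 v
  have hC0 : 0 ≤ C := le_trans (by positivity) (hc u)
  have hD : ‖D u‖ ≤ C / (1 + ‖u‖) ^ 5 := by
    rw [le_div_iff₀ (by positivity)]
    exact hc u
  rw [norm_smul, Real.norm_eq_abs, abs_of_pos (by positivity), ← ha2]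
  calc ((a ^ 2) ^ 2)⁻¹ * ‖D u (a⁻¹ • b)‖ ≤ ((a ^ 2) ^ 2)⁻¹ * (‖D u‖ * ‖a⁻¹ • b‖) := by
        gcongr
        exact (D u).le_opNorm _
    _ = (a ^ 4)⁻¹ * a⁻¹ * ‖b‖ * ‖D u‖ := by
        rw [norm_smul, Real.norm_eq_abs, abs_of_pos (inv_pos.2 ha0)]
        ring
    _ ≤ (a ^ 4)⁻¹ * a⁻¹ * ‖b‖ * (C / (1 + ‖u‖) ^ 5) := by gcongr
    _ = C * ‖b‖ / (a + ‖v‖) ^ 5 := by rw [h1]; field_simp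

/-- **Derivative in the scale parameter of the rescaled kernel**: with `b(s) = (νs)^{-1/2}`,
`(νs)⁻² K₁(v/√(νs)) = b(s)⁴ K₁(b(s) v)` and
`d/ds [b⁴ K₁(b v)] = -ν b⁶ (2 K₁(u) + ½ D(u) u)`, `u = b v`. [folklore] -/
theorem hasDerivAt_rescaled_time (hd : ∀ u, HasFDerivAt K₁ (D u) u) {ν : ℝ} (hν : 0 < ν) {s : ℝ}
    (hs : 0 < s) (v : ℝ³) :
    HasDerivAt (fun s : ℝ => ((ν * s) ^ (-(1 / 2 : ℝ))) ^ 4 • K₁ ((ν * s) ^ (-(1 / 2 : ℝ)) • v))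
      ((-(ν * ((ν * s) ^ (-(1 / 2 : ℝ))) ^ 6)) •
        (2 * K₁ ((ν * s) ^ (-(1 / 2 : ℝ)) • v) +
          (1 / 2 : ℂ) * D ((ν * s) ^ (-(1 / 2 : ℝ)) • v) ((ν * s) ^ (-(1 / 2 : ℝ)) • v))) s := by
  set bf : ℝ → ℝ := fun s => (ν * s) ^ (-(1 / 2 : ℝ)) with hbf
  have hθ : 0 < ν * s := mul_pos hν hs
  have hne : ν * s ≠ 0 := hθ.ne'
  have hb0 : 0 < bf s := Real.rpow_pos_of_pos hθ _
  -- derivative of `bf`: `-(ν/2) bf³`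
  have hlin : HasDerivAt (fun s : ℝ => ν * s) ν s := by
    simpa using (hasDerivAt_id s).const_mul ν
  have hbderiv : HasDerivAt bf (-(ν / 2) * bf s ^ 3) s := by
    have h := hlin.rpow_const (p := -(1 / 2 : ℝ)) (Or.inl hne)
    refine h.congr_deriv ?_
    rw [hbf]
    simp only
    have : (ν * s) ^ (-(1 / 2 : ℝ) - 1) = ((ν * s) ^ (-(1 / 2 : ℝ))) ^ 3 := by
      rw [← Real.rpow_natCast, ← Real.rpow_mul hθ.le]
      norm_num
    rw [this]
    ring
  -- the pieces
  have hpow : HasDerivAt (fun s : ℝ => bf s ^ 4) (4 * bf s ^ 3 * (-(ν / 2) * bf s ^ 3)) s := by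
    simpa using hbderiv.fun_pow 4
  have hinner : HasDerivAt (fun s : ℝ => bf s • v) ((-(ν / 2) * bf s ^ 3) • v) s :=
    hbderiv.smul_const v
  have hcomp : HasDerivAt (fun s : ℝ => K₁ (bf s • v)) (D (bf s • v) ((-(ν / 2) * bf s ^ 3) • v)) s :=
    (hd (bf s • v)).comp_hasDerivAt s hinner
  have hprod := hpow.fun_smul hcomp
  refine hprod.congr_deriv ?_
  -- algebra: express `v` through `u = bf s • v`
  set u : ℝ³ := bf s • v with hu
  have hDv : D u v = (bf s)⁻¹ • D u u := by
    rw [hu, map_smul, smul_smul, inv_mul_cancel₀ hb0.ne', one_smul]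
  rw [map_smul, hDv]
  simp only [Complex.real_smul, show (ν * s) ^ (-(1 / 2 : ℝ)) = bf s from rfl]
  push_cast
  field_simp
  ring

/-- **Bound for the time derivative**: from `|2K₁(u) + ½ D(u)u|(1+|u|)⁶ ≤ C`,
`‖ν b⁶ (2K₁(u) + ½D(u)u)‖ ≤ ν C/(√(νs) + |v|)⁶` with `b = (νs)^{-1/2}`, `u = bv`. [folklore] -/
theorem norm_rescaled_timeDeriv_le
    (he : ∀ u, ‖2 * K₁ u + (1 / 2 : ℂ) * D u u‖ * (1 + ‖u‖) ^ 6 ≤ C) {ν : ℝ} (hν : 0 < ν)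
    {s : ℝ} (hs : 0 < s) (v : ℝ³) :
    ‖(-(ν * ((ν * s) ^ (-(1 / 2 : ℝ))) ^ 6)) •
        (2 * K₁ ((ν * s) ^ (-(1 / 2 : ℝ)) • v) +
          (1 / 2 : ℂ) * D ((ν * s) ^ (-(1 / 2 : ℝ)) • v) ((ν * s) ^ (-(1 / 2 : ℝ)) • v))‖ ≤
      ν * C / (Real.sqrt (ν * s) + ‖v‖) ^ 6 := by
  have hθ : 0 < ν * s := mul_pos hν hs
  set a : ℝ := Real.sqrt (ν * s) with ha
  have ha0 : 0 < a := Real.sqrt_pos.2 hθ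
  have hba : (ν * s) ^ (-(1 / 2 : ℝ)) = a⁻¹ := by
    rw [ha, Real.sqrt_eq_rpow, ← Real.rpow_neg_one, ← Real.rpow_mul hθ.le]
    norm_num
  rw [hba]
  set u : ℝ³ := a⁻¹ • v with hu
  have hav : 0 < a + ‖v‖ := by positivity
  have h1 : 1 + ‖u‖ = (a + ‖v‖) / a := one_add_norm_inv_smul ha0 v
  have hC0 : 0 ≤ C := le_trans (by positivity) (he u)
  have hE : ‖2 * K₁ u + (1 / 2 : ℂ) * D u u‖ ≤ C / (1 + ‖u‖) ^ 6 := by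
    rw [le_div_iff₀ (by positivity)]
    exact he u
  rw [norm_smul, Real.norm_eq_abs, abs_neg, abs_of_pos (by positivity)]
  calc ν * a⁻¹ ^ 6 * ‖2 * K₁ u + (1 / 2 : ℂ) * D u u‖ ≤ ν * a⁻¹ ^ 6 * (C / (1 + ‖u‖) ^ 6) := by
        gcongr
    _ = ν * C / (a + ‖v‖) ^ 6 := by rw [h1]; field_simp

end Rescaled

/-! ### The parabolic estimates of `σ(D)W₊` and Prop. 13.4 -/

section Derivation

/-- `θ^{-1/2} = (√θ)⁻¹` for `θ > 0`. [folklore] -/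
theorem rpow_neg_half_eq_inv_sqrt {θ : ℝ} (hθ : 0 < θ) : θ ^ (-(1 / 2 : ℝ)) = (Real.sqrt θ)⁻¹ := by
  rw [Real.sqrt_eq_rpow, ← Real.rpow_neg_one, ← Real.rpow_mul hθ.le]
  norm_num

/-- `(θ^{-1/2})⁴ = (θ²)⁻¹` for `θ > 0`. [folklore] -/
theorem rpow_neg_half_pow_four {θ : ℝ} (hθ : 0 < θ) : (θ ^ (-(1 / 2 : ℝ))) ^ 4 = (θ ^ 2)⁻¹ := by
  rw [rpow_neg_half_eq_inv_sqrt hθ, inv_pow]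
  congr 1
  rw [show (4 : ℕ) = 2 * 2 by norm_num, pow_mul, Real.sq_sqrt hθ.le]

end Derivation

/-- The forward multiplier kernel vanishes for `τ ≤ 0`. [folklore] -/
theorem multiplierHeatKernelFwd_of_nonpos (ν : ℝ) (σ : ℝ³ → ℂ) {z : ℝ × ℝ³} (hz : z.1 ≤ 0) :
    multiplierHeatKernelFwd ν σ z = 0 := by
  simp [multiplierHeatKernelFwd, not_lt.2 hz]

namespace LemarieRieusset2016

/-- **The parabolic estimates of `σ(D)W₊ = 1_{t>0}σ(D)W_{νt}` from the estimates on `K₁`**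
(Lemarié-Rieusset 2016, Prop. 13.4, proof p. 465: "`|σ(D)W₊(t,x)| ≤ Cρ₂(t,x)⁻⁴` …
`|∂ₜσ(D)W₊(t,x)| ≤ Cρ₂(t,x)⁻⁶` and `|∇σ(D)W₊(t,x)| ≤ Cρ₂(t,x)⁻⁵`"): the kernel
`multiplierHeatKernelFwd ν σ` is measurable, satisfies the size bound `|K(z)|ρ₂(z)⁴ ≤ A`, and the
regularity bound `|K(z) - K(z - z')|ρ₂(z)⁵ ≤ Aρ₂(z')` for `2ρ₂(z') ≤ ρ₂(z)` when both times `z.1`,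
`z.1 - z'.1` are `≥ ρ₂(z')²` (the region `t > 0`, where the printed derivative bounds hold; across
`t = 0` the kernel jumps by `σ(D)δ ≠ 0`).
With `K(τ, y) = 1_{τ>0} (ντ)⁻² K₁(y/√(ντ))` (`multiplierHeatKernel_scaling`): measurability is
that of the formula (`K₁` is continuous); the size bound is `|K| ≤ C(√(ντ) + |y|)⁻⁴ ≤ Cκ⁻⁴ρ₂⁻⁴`,
`κ = min(√ν, 1)`; the regularity bound for `2ρ₂(z') ≤ ρ₂(z)`, `ρ₂(z')² ≤ τ, τ - τ'` (so both times
are positive and the space segment at time `τ` and the time segment at `y - y'` stay at parabolic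
distance `≥ ρ₂(z)/2` from the origin) is the mean value inequality with
`|∇K| ≤ C(√(ντ)+|y|)⁻⁵` (`norm_rescaled_spaceDeriv_le`) and `|∂τK| ≤ νC(√(ντ)+|y|)⁻⁶`
(`norm_rescaled_timeDeriv_le`). [cite: LemarieRieusset2016, Prop. 13.4 proof p. 465] -/
theorem multiplierHeatKernelFwd_estimates (h : gaussianMultiplierKernel_estimates) {ν : ℝ}
    {σ : ℝ³ → ℂ} (hν : 0 < ν) (hσ : ContDiffOn ℝ ((⊤ : ℕ∞) : WithTop ℕ∞) σ {0}ᶜ)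
    (hhom : ∀ c : ℝ, 0 < c → ∀ ξ : ℝ³, σ (c • ξ) = (c : ℂ) * σ ξ) :
    Measurable (multiplierHeatKernelFwd ν σ : ℝ × ℝ³ → ℂ) ∧
    ∃ A : ℝ, (∀ z : ℝ × ℝ³, ‖multiplierHeatKernelFwd ν σ z‖ * parabolicNorm z ^ (4 : ℝ) ≤ A) ∧
      ∀ z z' : ℝ × ℝ³, 2 * parabolicNorm z' ≤ parabolicNorm z → parabolicNorm z' ^ 2 ≤ z.1 →
        parabolicNorm z' ^ 2 ≤ z.1 - z'.1 →
        ‖multiplierHeatKernelFwd ν σ z - multiplierHeatKernelFwd ν σ (z - z')‖ *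
            parabolicNorm z ^ ((4 : ℝ) + 1) ≤ A * parabolicNorm z' := by
  obtain ⟨D, C, hd, hb, hc, he⟩ := h σ hσ hhom
  set K₁ : ℝ³ → ℂ := multiplierHeatKernel σ 1 with hK₁
  have hC0 : 0 ≤ C := le_trans (by positivity) (hb 0)
  -- the kernel for `τ > 0` and `τ ≤ 0`
  have hform : ∀ (τ : ℝ) (y : ℝ³), 0 < τ →
      multiplierHeatKernelFwd ν σ (τ, y) = (((ν * τ) ^ 2)⁻¹ : ℝ) • K₁ ((Real.sqrt (ν * τ))⁻¹ • y) := by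
    intro τ y hτ
    rw [multiplierHeatKernelFwd, if_pos (show (0 : ℝ) < ((τ, y) : ℝ × ℝ³).1 from hτ)]
    exact multiplierHeatKernel_scaling hhom (mul_pos hν hτ) y
  have hzero : ∀ z : ℝ × ℝ³, z.1 ≤ 0 → multiplierHeatKernelFwd ν σ z = 0 := fun z hz =>
    multiplierHeatKernelFwd_of_nonpos ν σ hz
  -- `κ = min(√ν, 1)`: `√(ντ) + |y| ≥ κ ρ₂(τ, y)`
  set κ : ℝ := min (Real.sqrt ν) 1 with hκ
  have hκ0 : 0 < κ := lt_min (Real.sqrt_pos.2 hν) one_pos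
  have hκle : ∀ (τ : ℝ) (y : ℝ³), 0 ≤ τ →
      κ * parabolicNorm ((τ, y) : ℝ × ℝ³) ≤ Real.sqrt (ν * τ) + ‖y‖ := by
    intro τ y hτ
    rw [parabolicNorm_mk_of_nonneg hτ, Real.sqrt_mul hν.le]
    have h1 : κ ≤ Real.sqrt ν := min_le_left _ _
    have h2 : κ ≤ 1 := min_le_right _ _
    have := Real.sqrt_nonneg τ
    have := norm_nonneg y
    nlinarith
  refine ⟨?_, ?_⟩
  · -- measurability
    have hK₁c : Continuous K₁ := continuous_iff_continuousAt.2 fun u => (hd u).continuousAt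
    have hfun : (multiplierHeatKernelFwd ν σ : ℝ × ℝ³ → ℂ) = fun p =>
        if 0 < p.1 then (((ν * p.1) ^ 2)⁻¹ : ℝ) • K₁ ((Real.sqrt (ν * p.1))⁻¹ • p.2) else 0 := by
      funext p
      by_cases hp : 0 < p.1
      · rw [if_pos hp]
        exact hform p.1 p.2 hp
      · rw [if_neg hp]
        exact hzero p (not_lt.1 hp)
    rw [hfun]
    refine Measurable.ite (measurableSet_lt measurable_const measurable_fst) ?_ measurable_const
    have h1 : Measurable fun p : ℝ × ℝ³ => ((ν * p.1) ^ 2)⁻¹ :=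
      ((measurable_const.mul measurable_fst).pow_const 2).inv
    have h2 : Measurable fun p : ℝ × ℝ³ => (Real.sqrt (ν * p.1))⁻¹ • p.2 :=
      ((Real.continuous_sqrt.measurable.comp (measurable_const.mul measurable_fst)).inv).smul
        measurable_snd
    exact h1.smul (hK₁c.measurable.comp h2)
  · -- the two bounds, with `A = max (C/κ⁴) (32C/κ⁵ + 32νC/κ⁶)`
    set A : ℝ := max (C / κ ^ 4) (32 * C / κ ^ 5 + 32 * ν * C / κ ^ 6) with hA
    refine ⟨A, fun z => ?_, fun z z' h2ρ hc1 hc2 => ?_⟩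
    · -- size
      rw [show (4 : ℝ) = ((4 : ℕ) : ℝ) by norm_num, Real.rpow_natCast]
      rcases le_or_gt z.1 0 with hτ | hτ
      · rw [hzero z hτ, norm_zero, zero_mul]
        exact le_trans (by positivity) (le_max_left _ _)
      · obtain ⟨τ, y⟩ := z
        simp only at hτ
        rw [hform τ y hτ]
        set ρ : ℝ := parabolicNorm ((τ, y) : ℝ × ℝ³) with hρ
        have hρκ := hκle τ y hτ.le
        rw [← hρ] at hρκ
        have hρ0 : 0 < ρ := by
          rw [hρ, parabolicNorm_mk_of_nonneg hτ.le]
          have := Real.sqrt_pos.2 hτ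
          linarith [norm_nonneg y]
        have hκρ : 0 < κ * ρ := by positivity
        have H := norm_rescaled_le (K₁ := K₁) hb (mul_pos hν hτ) y
        calc ‖(((ν * τ) ^ 2)⁻¹ : ℝ) • K₁ ((Real.sqrt (ν * τ))⁻¹ • y)‖ * ρ ^ 4
            ≤ C / (Real.sqrt (ν * τ) + ‖y‖) ^ 4 * ρ ^ 4 := by gcongr
          _ ≤ C / (κ * ρ) ^ 4 * ρ ^ 4 := by
              gcongr
          _ = C / κ ^ 4 := by field_simp
          _ ≤ A := le_max_left _ _
    · -- regularity
      rw [show (4 : ℝ) + 1 = ((5 : ℕ) : ℝ) by norm_num, Real.rpow_natCast]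
      set r : ℝ := parabolicNorm z' with hr
      have hr0 : 0 ≤ r := parabolicNorm_nonneg _
      rcases hr0.eq_or_lt with hr00 | hrpos
      · have hz' : z' = 0 := (parabolicNorm_eq_zero_iff _).1 hr00.symm
        rw [hz', sub_zero, sub_self, norm_zero, zero_mul, ← hr00, mul_zero]
      obtain ⟨τ, y⟩ := z
      obtain ⟨τ', y'⟩ := z'
      rw [Prod.mk_sub_mk]
      simp only at hc1 hc2
      have hτ : 0 < τ := by nlinarith
      have hτ₂ : 0 < τ - τ' := by nlinarith
      rw [hform τ y hτ, hform (τ - τ') (y - y') hτ₂]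
      set ρ₀ : ℝ := parabolicNorm ((τ, y) : ℝ × ℝ³) with hρ₀
      have h2r : 2 * r ≤ ρ₀ := h2ρ
      have hy'r : ‖y'‖ ≤ r := norm_le_parabolicNorm τ' y'
      have hτ'r : |τ'| ≤ r ^ 2 := abs_le_parabolicNorm_sq τ' y'
      have hρ₀eq : ρ₀ = Real.sqrt τ + ‖y‖ := by rw [hρ₀, parabolicNorm_mk_of_nonneg hτ.le]
      have hρ₀pos : 0 < ρ₀ := by linarith
      have hρ₂ : ρ₀ / 2 ≤ parabolicNorm ((τ - τ', y - y') : ℝ × ℝ³) := by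
        have h := parabolicNorm_add_le ((τ - τ', y - y') : ℝ × ℝ³) ((τ', y') : ℝ × ℝ³)
        have he : ((τ - τ', y - y') : ℝ × ℝ³) + ((τ', y') : ℝ × ℝ³) = (τ, y) := by
          ext <;> simp
        rw [he, ← hρ₀, ← hr] at h
        linarith
      set R : ℝ := ρ₀ / 2 with hR
      have hR0 : 0 < R := by rw [hR]; linarith
      have hκR : 0 < κ * R := by positivity
      -- the kernel at fixed positive time as a function of space
      -- space step at time `τ`
      have D1 : ‖(((ν * τ) ^ 2)⁻¹ : ℝ) • K₁ ((Real.sqrt (ν * τ))⁻¹ • y) -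
          (((ν * τ) ^ 2)⁻¹ : ℝ) • K₁ ((Real.sqrt (ν * τ))⁻¹ • (y - y'))‖ ≤ C * ‖y'‖ / (κ * R) ^ 5 := by
        have hθ : 0 < ν * τ := mul_pos hν hτ
        have hderiv : ∀ μ ∈ Icc (0 : ℝ) 1,
            HasDerivWithinAt (fun μ : ℝ => (((ν * τ) ^ 2)⁻¹ : ℝ) •
                K₁ ((Real.sqrt (ν * τ))⁻¹ • ((y - y') + μ • y')))
              ((((ν * τ) ^ 2)⁻¹ : ℝ) • D ((Real.sqrt (ν * τ))⁻¹ • ((y - y') + μ • y'))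
                ((Real.sqrt (ν * τ))⁻¹ • y')) (Icc (0 : ℝ) 1) μ := fun μ _ =>
          (hasDerivAt_rescaled_segment hd (ν * τ) (y - y') y' μ).hasDerivWithinAt
        have hbound : ∀ μ ∈ Ico (0 : ℝ) 1,
            ‖(((ν * τ) ^ 2)⁻¹ : ℝ) • D ((Real.sqrt (ν * τ))⁻¹ • ((y - y') + μ • y'))
                ((Real.sqrt (ν * τ))⁻¹ • y')‖ ≤ C * ‖y'‖ / (κ * R) ^ 5 := by
          intro μ hμ
          set v : ℝ³ := (y - y') + μ • y' with hv
          have hvR : R ≤ parabolicNorm ((τ, v) : ℝ × ℝ³) := by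
            rw [parabolicNorm_mk_of_nonneg hτ.le]
            have e : v = y - (1 - μ) • y' := by
              rw [hv, sub_smul, one_smul]
              abel
            have h1 : ‖(1 - μ) • y'‖ ≤ ‖y'‖ := by
              rw [norm_smul, Real.norm_eq_abs, abs_of_nonneg (by linarith [hμ.2])]
              nlinarith [norm_nonneg y', hμ.1, hμ.2]
            have h2 : ‖y‖ - ‖(1 - μ) • y'‖ ≤ ‖v‖ := by
              rw [e]
              exact norm_sub_norm_le y ((1 - μ) • y')
            rw [hR, hρ₀eq]
            linarith
          have hκv : κ * R ≤ Real.sqrt (ν * τ) + ‖v‖ :=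
            le_trans (mul_le_mul_of_nonneg_left hvR hκ0.le) (hκle τ v hτ.le)
          calc ‖(((ν * τ) ^ 2)⁻¹ : ℝ) • D ((Real.sqrt (ν * τ))⁻¹ • v) ((Real.sqrt (ν * τ))⁻¹ • y')‖
              ≤ C * ‖y'‖ / (Real.sqrt (ν * τ) + ‖v‖) ^ 5 := norm_rescaled_spaceDeriv_le hc hθ v y'
            _ ≤ C * ‖y'‖ / (κ * R) ^ 5 :=
                div_le_div_of_nonneg_left (by positivity) (by positivity) (pow_le_pow_left₀ hκR.le hκv 5)
        have := norm_image_sub_le_of_norm_deriv_le_segment_01' hderiv hbound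
        simpa only [one_smul, sub_add_cancel, zero_smul, add_zero] using this
      -- time step at `v = y - y'`
      have D2 : ‖(((ν * τ) ^ 2)⁻¹ : ℝ) • K₁ ((Real.sqrt (ν * τ))⁻¹ • (y - y')) -
          (((ν * (τ - τ')) ^ 2)⁻¹ : ℝ) • K₁ ((Real.sqrt (ν * (τ - τ')))⁻¹ • (y - y'))‖ ≤
            ν * C / (κ * R) ^ 6 * |τ'| := by
        set v : ℝ³ := y - y' with hv
        set S : Set ℝ := Icc (min τ (τ - τ')) (max τ (τ - τ')) with hS
        have hSpos : ∀ s ∈ S, 0 < s := fun s hs => (lt_min hτ hτ₂).trans_le hs.1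
        -- the function in the two forms
        have heq : ∀ s : ℝ, 0 < s → ((ν * s) ^ (-(1 / 2 : ℝ))) ^ 4 • K₁ ((ν * s) ^ (-(1 / 2 : ℝ)) • v) =
            (((ν * s) ^ 2)⁻¹ : ℝ) • K₁ ((Real.sqrt (ν * s))⁻¹ • v) := by
          intro s hs
          have hθ : 0 < ν * s := mul_pos hν hs
          rw [rpow_neg_half_pow_four hθ, rpow_neg_half_eq_inv_sqrt hθ]
        have hderiv : ∀ s ∈ S, HasDerivWithinAt
            (fun s : ℝ => (((ν * s) ^ 2)⁻¹ : ℝ) • K₁ ((Real.sqrt (ν * s))⁻¹ • v))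
            ((-(ν * ((ν * s) ^ (-(1 / 2 : ℝ))) ^ 6)) •
              (2 * K₁ ((ν * s) ^ (-(1 / 2 : ℝ)) • v) +
                (1 / 2 : ℂ) * D ((ν * s) ^ (-(1 / 2 : ℝ)) • v) ((ν * s) ^ (-(1 / 2 : ℝ)) • v))) S s := by
          intro s hs
          have hs0 := hSpos s hs
          have hev : (fun s : ℝ => ((ν * s) ^ (-(1 / 2 : ℝ))) ^ 4 • K₁ ((ν * s) ^ (-(1 / 2 : ℝ)) • v))
              =ᶠ[nhds s] fun s : ℝ => (((ν * s) ^ 2)⁻¹ : ℝ) • K₁ ((Real.sqrt (ν * s))⁻¹ • v) := by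
            filter_upwards [Ioi_mem_nhds hs0] with s' hs'
            exact heq s' hs'
          exact ((hasDerivAt_rescaled_time hd hν hs0 v).congr_of_eventuallyEq hev.symm).hasDerivWithinAt
        have hbound : ∀ s ∈ S, ‖(-(ν * ((ν * s) ^ (-(1 / 2 : ℝ))) ^ 6)) •
              (2 * K₁ ((ν * s) ^ (-(1 / 2 : ℝ)) • v) +
                (1 / 2 : ℂ) * D ((ν * s) ^ (-(1 / 2 : ℝ)) • v) ((ν * s) ^ (-(1 / 2 : ℝ)) • v))‖ ≤
              ν * C / (κ * R) ^ 6 := by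
          intro s hs
          have hs0 := hSpos s hs
          have hmin : R ≤ parabolicNorm ((min τ (τ - τ'), v) : ℝ × ℝ³) := by
            rcases le_total τ (τ - τ') with hle | hle
            · rw [min_eq_left hle, parabolicNorm_mk_of_nonneg hτ.le]
              have := norm_sub_norm_le y y'
              rw [hR, hρ₀eq, hv]
              linarith
            · rw [min_eq_right hle]
              exact hρ₂
          have hρs : R ≤ parabolicNorm ((s, v) : ℝ × ℝ³) :=
            hmin.trans (parabolicNorm_mk_mono (lt_min hτ hτ₂).le hs.1 v)
          have hκv : κ * R ≤ Real.sqrt (ν * s) + ‖v‖ :=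
            le_trans (mul_le_mul_of_nonneg_left hρs hκ0.le) (hκle s v hs0.le)
          calc _ ≤ ν * C / (Real.sqrt (ν * s) + ‖v‖) ^ 6 := norm_rescaled_timeDeriv_le he hν hs0 v
            _ ≤ ν * C / (κ * R) ^ 6 :=
                div_le_div_of_nonneg_left (by positivity) (by positivity) (pow_le_pow_left₀ hκR.le hκv 6)
        have hconv : Convex ℝ S := convex_Icc _ _
        have hτS : τ ∈ S := ⟨min_le_left _ _, le_max_left _ _⟩
        have hτ₂S : τ - τ' ∈ S := ⟨min_le_right _ _, le_max_right _ _⟩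
        have := hconv.norm_image_sub_le_of_norm_hasDerivWithin_le hderiv hbound hτ₂S hτS
        rw [Real.norm_eq_abs, show τ - (τ - τ') = τ' by ring] at this
        exact this
      -- combine
      have hrR : r / ρ₀ ≤ 1 / 2 := by
        rw [div_le_iff₀ hρ₀pos]
        linarith
      calc ‖(((ν * τ) ^ 2)⁻¹ : ℝ) • K₁ ((Real.sqrt (ν * τ))⁻¹ • y) -
            (((ν * (τ - τ')) ^ 2)⁻¹ : ℝ) • K₁ ((Real.sqrt (ν * (τ - τ')))⁻¹ • (y - y'))‖ * ρ₀ ^ 5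
          ≤ (‖(((ν * τ) ^ 2)⁻¹ : ℝ) • K₁ ((Real.sqrt (ν * τ))⁻¹ • y) -
                (((ν * τ) ^ 2)⁻¹ : ℝ) • K₁ ((Real.sqrt (ν * τ))⁻¹ • (y - y'))‖ +
              ‖(((ν * τ) ^ 2)⁻¹ : ℝ) • K₁ ((Real.sqrt (ν * τ))⁻¹ • (y - y')) -
                (((ν * (τ - τ')) ^ 2)⁻¹ : ℝ) • K₁ ((Real.sqrt (ν * (τ - τ')))⁻¹ • (y - y'))‖) * ρ₀ ^ 5 := by
            gcongr
            exact norm_sub_le_norm_sub_add_norm_sub _ _ _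
        _ ≤ (C * ‖y'‖ / (κ * R) ^ 5 + ν * C / (κ * R) ^ 6 * |τ'|) * ρ₀ ^ 5 := by gcongr
        _ ≤ (C * r / (κ * R) ^ 5 + ν * C / (κ * R) ^ 6 * r ^ 2) * ρ₀ ^ 5 := by gcongr
        _ = 32 * C / κ ^ 5 * r + 64 * ν * C / κ ^ 6 * r * (r / ρ₀) := by
            rw [hR]
            field_simp
            ring
        _ ≤ 32 * C / κ ^ 5 * r + 64 * ν * C / κ ^ 6 * r * (1 / 2) := by gcongr
        _ = (32 * C / κ ^ 5 + 32 * ν * C / κ ^ 6) * r := by ring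
        _ ≤ A * r := mul_le_mul_of_nonneg_right (le_max_right _ _) hr0

/-- **The multiplier part of Prop. 13.4 from the estimates on `K₁`** (Lemarié-Rieusset 2016,
Prop. 13.4, p. 464, term `σ(D)g`): given `gaussianMultiplierKernel_estimates`, for `g ∈ ℳ₂^{p,q₁}`,
`1/q₁ = 1/5 - α/5`, `0 < α < 1`, the potential `multiplierHeatPotential ν σ (1_{s>0} g)` is
parabolic-Hölder of exponent `α` on `ℝ × ℝ³`: the forward-kernel theorem
`parabolicHolderOnWith_integral_of_kernel_bounds_fwd` with `m = 4`, `d = 5(1 - 1/q₁) = 4 + α`,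
the `L¹`-Morrey bound `exists_morrey_one_bound`, the kernel estimates
`multiplierHeatKernelFwd_estimates`, and the absolute convergence `integrable_kernel_mul_of_morrey_fwd`. [cite: LemarieRieusset2016, Prop. 13.4 p. 464] -/
theorem prop13_4_multiplierPart_of_gaussian (h : gaussianMultiplierKernel_estimates) :
    prop13_4_multiplierPart := by
  intro ν p q₀ q₁ α σ g hν hp hpq₀ hq₀q₁ h1 h0 hα0 hα1 hσ hhom hg hMg
  obtain ⟨hKmeas, A, hK1, hK2⟩ := multiplierHeatKernelFwd_estimates h hν hσ hhom
  -- `q₁ > 0`, `d = 4 + α`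
  have hq₁pos : 0 < q₁ := by
    by_contra hle
    have : 1 / q₁ ≤ 0 := one_div_nonpos.2 (not_lt.1 hle)
    linarith
  set d : ℝ := 5 * (1 - 1 / q₁) with hd
  have hdα : d = 4 + α := by rw [hd, h1]; ring
  have hd4 : 4 < d := by rw [hdα]; linarith
  have hd5 : d < 4 + 1 := by rw [hdα]; linarith
  -- the data
  set S : Set (ℝ × ℝ³) := Ioi (0 : ℝ) ×ˢ (univ : Set ℝ³) with hS
  have hSm : MeasurableSet S := measurableSet_Ioi.prod MeasurableSet.univ
  set G : ℝ × ℝ³ → ℂ := fun w => ((S.indicator g w : ℝ) : ℂ) with hG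
  have hGm : Measurable G := Complex.measurable_ofReal.comp (hg.indicator hSm)
  have hGle : ∀ w, ‖G w‖ₑ ≤ ‖g w‖ₑ := by
    intro w
    rw [hG]
    simp only
    rw [← ofReal_norm, ← ofReal_norm, Complex.norm_real]
    apply ENNReal.ofReal_le_ofReal
    by_cases hw : w ∈ S
    · rw [indicator_of_mem hw]
    · rw [indicator_of_notMem hw, norm_zero]
      exact norm_nonneg _
  have hMG : IsParabolicMorreyOn univ (fun w => ‖G w‖ₑ) p q₁ :=
    hMg.of_le MeasurableSet.univ (by linarith) fun w _ => hGle w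
  obtain ⟨B, hB0, hB⟩ := exists_morrey_one_bound hp hGm.enorm.aemeasurable hMG
  have hGT : ∀ w : ℝ × ℝ³, w.1 ≤ 0 → G w = 0 := by
    intro w hw
    have : w ∉ S := by
      rw [hS, mem_prod, mem_Ioi]
      exact fun h' => absurd h'.1 (not_lt.2 hw)
    simp [hG, indicator_of_notMem this]
  -- the kernel
  have hK0 : ∀ z : ℝ × ℝ³, z.1 ≤ 0 → multiplierHeatKernelFwd ν σ z = 0 := fun z hz =>
    multiplierHeatKernelFwd_of_nonpos ν σ hz
  have hint : ∀ z, Integrable (fun w => multiplierHeatKernelFwd ν σ (z - w) * G w) := fun z =>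
    integrable_kernel_mul_of_morrey_fwd hKmeas hGm hB0 (by norm_num : (3 : ℝ) < 4) hd4 hK0 hK1
      hGT hB z
  have H := parabolicHolderOnWith_integral_of_kernel_bounds_fwd hKmeas hGm hB0
    (by norm_num : (3 : ℝ) < 4) hd4 hd5 hK0 hK1 hK2 hB hint
  refine ⟨kernelHolderConstFwd A B 4 d, ?_⟩
  have hexp : d - 4 = α := by rw [hdα]; ring
  rw [← hexp]
  exact H

/-- **Prop. 13.4 from the estimates on `K₁`** (Lemarié-Rieusset 2016, Prop. 13.4, p. 464):
`gaussianMultiplierKernel_estimates → prop13_4`, through `prop13_4_multiplierPart_of_gaussian`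
and `prop13_4_of_multiplierPart` (the heat-kernel part being proved). [cite: LemarieRieusset2016, Prop. 13.4 p. 464] -/
theorem prop13_4_of_gaussian (h : gaussianMultiplierKernel_estimates) : prop13_4 :=
  prop13_4_of_multiplierPart (prop13_4_multiplierPart_of_gaussian h)

end LemarieRieusset2016

end Literature.Analysis.FluidPDE
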